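import Mathlib.Algebra.Category.Grp.Basic
import Mathlib.Topology.Instances.ZMod
import Mathlib.RingTheory.RootsOfUnity.Complex
import Literature.IUT.HodgeArakelov.Prop13SubExample32UniversalClosures
import Literature.IUT.HodgeArakelov.ModelCyclotomes
import Literature.AnabelianGeometry.EtaleTheta.CyclotomeZHatAction

/-!
# [IUTchII] §1: a CLOSED inhabitant of the typed interface chain Def. 1.1 (i)(ii) / Prop. 1.2 (ii) / Prop. 1.3 (i)(ii),
# and what Prop. 1.3 (i)(ii)(iii) AS TYPED does at it (rows F-0420 `Prop13_i_ii`, F-0664 `Prop13_iii`)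

S. Mochizuki, *Inter-universal Teichmüller theory II*, §1: the data fixed on p. 20, Definition 1.1 (i), (ii)
(pp. 20–21), Proposition 1.2 (ii) (pp. 25–26), Proposition 1.3 (i)–(iii) (pp. 26–27), kurims manuscript (Dec. 2020).
Record-only under the claim key `Mochizuki2012` (D-0012, disputed). abc-iut cell (block F, seat abc-iut-f-185,
F-TRANCHES tranche 185; companion `Prop13SubClosedUniversalClosures.lean` decides the universal closures of the
Prop. 1.3 (ii)/(iii) sub-node rows F-2780…F-2783 over ALL binders using the objects built here).

WHY. The cell's typings of [IUTchII] §1 (abc-iut-L6-t1, p405104 / p406189) are INTERFACES — `ThetaSetting`,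
`MonoThetaEnv`, `Reconstruction`, `CyclotomicRigidity`, `TemperedFrobenioidData`, `EnvOfFrobenioid`,
`FrobenioidCyclotomes`, `BsGalData` — and the tree held NO closed term of the last seven (only binders, and genuine but
hypothesis-laden producers such as `EnvOfFrobenioid.ofBiTheta`), so statements "for all such data" about the Prop. 1.3
predicates were relative (p430842: «∀ κ ↔ binder type empty ∨ `Aut ν = 1`») or conditional. ONE closed, deliberately
degenerate datum decides such closures in kernel and certifies non-vacuity of the chain (ADJUDICATION-SPEC §4(iii)):

* §0 `zhatModPowEquiv N : ModPow Ẑ N ≃* ℤ/Nℤ` — abc-iut-L6-t1's reduction `A ⊗ ℤ/N := A/⟪A^N⟫` of the tree's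
  `Ẑ = Literature.IUT.HodgeTheaters.ZHat` IS `ℤ/Nℤ` (from `ZHatLevel.level_eq_one_iff_exists_pow`, `Ker(Ẑ → ℤ/N) = Ẑ^N`,
  [RibesZalesskii2010, Thm 2.7.1]); classical, reusable.
* §2–§4 THE TOY (`N := 3`, `l := 3`, `p := 5`, `k := ℂ`): `setting` (`Π^tp := Ẑ =: G_k`, `aug := id`, so `Δ = 1`);
  `mte : MonoThetaEnv setting` (`Π := Ẑ × μ_3`, `D_Π := Inn`, `s^Θ := ∅`, isomorphic to the model by the identity);
  `recon : Reconstruction mte` (`Π_Y := Π_X := G := Ẑ`, first projection / identities, `(l·Δ_Θ) := Ẑ/1 ≅ Ẑ`,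
  `Π_μ := Ker(Ẑ × μ_3 ↠ Ẑ) ≅ ℤ/3`, trivial actions); `rigidity : CyclotomicRigidity recon` (`Ẑ/1 ⊗ ℤ/3 ≅ ℤ/3 ≅ Π_μ`);
  `frd : TemperedFrobenioidData setting` (`𝒞 := 𝒟 := Type`, `B^temp(-)⁰ := Type`); `envOfFrd`; `cyc :
  FrobenioidCyclotomes envOfFrd` (`S := μ_3 ∈ Type`, `μ_N(S) := O^×(S) :=` the Cayley image of `μ_3` in
  `Aut_{Type}(S)`, `(l·Δ_Θ)_S ⊗ ℤ/3 :=` the same image as a subquotient); `bsGalData : BsGalData cyc` (all [AbsTopIII]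
  cyclotomes `:= μ_3`, natural isomorphisms `:= id`).
* §5 AT THE TOY: `prop13_i_ii_envOfFrd` — **F-0420 `Prop13_i_ii` is inhabited** (first closed witness);
  `prop13_iii_toy` — **F-0664 `Prop13_iii rigidity cyc bsGalData` HOLDS** (`(*mono-Θ) = (*bs-Gal)`, both being
  `(l·Δ_Θ)_S ⊗ ℤ/3 ⥲ μ_3 ⥲ μ_N(S)`); `muNFlip`/`muNFlip_ne_refl` — inversion is a non-identity automorphism of
  `μ_N(S) ≅ μ_3`; `bsGalDataFlip` — the SAME Prop. 1.3 (ii) interface re-gauged by it — and `not_prop13_iii_flip`: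
  **`Prop13_iii rigidity cyc bsGalDataFlip` FAILS**.
* §6 a second junk Prop. 1.2 (ii) input `frdPoint` (`𝒞 :=` one object with `Aut = 1`) over the same environment:
  `not_prop13_i_ii_envOfFrdPoint` — **`Prop13_i_ii` FAILS** there (`μ_N(S) ⊆ Aut(S) = 1` cannot receive `Π_μ ≅ μ_3`).

READING (FACT-LIST R5 / plan R1): F-0420, F-0664 are thereby INDEPENDENT of the typed interfaces — conditions on the
data (`𝒞` IS the tempered Frobenioid of `X̲̲_k`, [EtTh] §5; the [AbsTopIII] data of (ii) are the NATURAL ones,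
GAP-LEDGER G-w4d042-1), as their `conditional(G: …)` labels (w4-d042) say; the companion file states the closures.

HONEST FRAMING: JUNK DATA by design (no curve, no scheme-theoretic Frobenioid, `Δ = 1`, empty theta section); an
inhabitant certifies non-vacuity of the interfaces and decides universal closures, nothing more. Nothing here asserts
or refutes anything in print, bears on [IUTchIII] Cor. 3.12, or takes a side; typed ≠ proved. Elementary group theory
over Mathlib (`profiniteCompletion ℤ`, `ZMod 3`, `Equiv.Perm`, `InducedCategory`); no instance/notation/attribute declared.
-/

noncomputable section

open CategoryTheory Topology

namespace Literature.IUT.HodgeArakelov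

namespace Prop13Toy

open Literature.AnabelianGeometry.EtaleTheta

/-! ## 0. `Ẑ ⊗ ℤ/Nℤ ≅ ℤ/Nℤ` -/

/-- The level-`N` character `Ẑ → ℤ/Nℤ` is surjective. [cite: RibesZalesskii2010, Thm 2.7.1] -/
theorem level_surjective (N : ℕ+) : Function.Surjective (ZHatLevel.level N) := fun y => by
  obtain ⟨k, hk⟩ := ZMod.intCast_surjective (Multiplicative.toAdd y)
  exact ⟨ZHatLevel.eta k, by rw [ZHatLevel.level_eta, hk, ofAdd_toAdd]⟩

/-- In `Ẑ` the normal closure of the `N`-th powers is the kernel of `Ẑ → ℤ/Nℤ` (it IS the set of `N`-th powers,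
`ZHatLevel.level_eq_one_iff_exists_pow`). [cite: RibesZalesskii2010, Thm 2.7.1] -/
theorem normalClosure_pow_eq_ker_level (N : ℕ+) :
    Subgroup.normalClosure (Set.range fun a : Literature.IUT.HodgeTheaters.ZHat => a ^ (N : ℕ)) =
      (ZHatLevel.level N).ker := by
  apply le_antisymm
  · apply Subgroup.normalClosure_le_normal
    rintro _ ⟨a, rfl⟩
    rw [SetLike.mem_coe, MonoidHom.mem_ker]
    exact ZHatLevel.level_pow_self N a
  · intro y hy
    obtain ⟨z, rfl⟩ := (ZHatLevel.level_eq_one_iff_exists_pow N y).mp hy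
    exact Subgroup.subset_normalClosure ⟨z, rfl⟩

/-- `Ẑ ⊗ ℤ/Nℤ ≅ ℤ/Nℤ`: abc-iut-L6-t1's reduction `ModPow Ẑ N = Ẑ/⟪Ẑ^N⟫` of the tree's `Ẑ` is `ℤ/Nℤ`, via the level-`N`
character. [cite: RibesZalesskii2010, Thm 2.7.1] -/
def zhatModPowEquiv (N : ℕ+) :
    ModPow Literature.IUT.HodgeTheaters.ZHat (N : ℕ) ≃* Multiplicative (ZMod N) :=
  (QuotientGroup.quotientMulEquivOfEq (normalClosure_pow_eq_ker_level N)).trans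
    (QuotientGroup.quotientKerEquivOfSurjective _ (level_surjective N))

/-! ## 1. Generic plumbing: subgroups as subquotients, inner automorphisms, the Cayley embedding in `Type` -/

/-- A subgroup `H ≤ Q` read as the subquotient `H/1` (abc-iut-L6-t2's `Subquotient`).
[claim: Mochizuki2012, status: disputed] (IUTchII §1 Def 1.1 (i), kurims p.21) -/
@[reducible] def subSubquotient {Q : Type} [Group Q] (H : Subgroup Q) : Subquotient Q where
  top := H
  bot := ⊥
  le := bot_le
  normal := by rw [Subgroup.bot_subgroupOf]; infer_instance

/-- The carrier of `H/1` is `H`. [claim: Mochizuki2012, status: disputed] (IUTchII §1 Def 1.1 (i), kurims p.21) -/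
def subCarrierEquiv {Q : Type} [Group Q] (H : Subgroup Q) : (subSubquotient H).carrier ≃* H :=
  (QuotientGroup.quotientMulEquivOfEq (Subgroup.bot_subgroupOf H)).trans (QuotientGroup.quotientBot)

/-- The carrier of `Q/1` is `Q`. [claim: Mochizuki2012, status: disputed] (IUTchII §1 Def 1.1 (i), kurims p.21) -/
def wholeCarrierEquiv (Q : Type) [Group Q] : (subSubquotient (⊤ : Subgroup Q)).carrier ≃* Q :=
  (subCarrierEquiv ⊤).trans Subgroup.topEquiv

/-- Inner automorphisms of a topological group are bi-continuous (private plumbing). [folklore] -/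
private theorem continuous_of_mem_range_conj {G : Type} [Group G] [TopologicalSpace G] [IsTopologicalGroup G]
    (φ : MulAut G) (hφ : φ ∈ (MulAut.conj : G →* MulAut G).range) :
    Continuous φ ∧ Continuous φ.symm := by
  obtain ⟨g, rfl⟩ := hφ
  have h1 : ((MulAut.conj g : MulAut G) : G → G) = fun x => g * x * g⁻¹ :=
    funext fun x => MulAut.conj_apply g x
  have h2 : ((MulAut.conj g : MulAut G).symm : G → G) = fun x => g⁻¹ * x * g⁻¹⁻¹ := by
    funext x
    rw [← MulAut.inv_def, ← map_inv, MulAut.conj_apply]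
  refine ⟨?_, ?_⟩
  · rw [h1]; exact (continuous_const.mul continuous_id).mul continuous_const
  · rw [h2]; exact (continuous_const.mul continuous_id).mul continuous_const

/-- The Cayley embedding `A ↪ Aut_{Type}(A)` (left translations, read in the category `Type` through Mathlib's
`Aut A ≃* Equiv.Perm A`). [folklore] -/
def cayley (A : Type) [Group A] : A →* Aut A :=
  (CategoryTheory.Aut.mulEquivPerm (α := A)).symm.toMonoidHom.comp (MulAction.toPermHom A A)

/-- The Cayley embedding is injective (private plumbing). [folklore] -/
private theorem cayley_injective (A : Type) [Group A] : Function.Injective (cayley A) :=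
  (CategoryTheory.Aut.mulEquivPerm (α := A)).symm.injective.comp MulAction.toPerm_injective

/-! ## 2. The toy groups and the toy setting -/

/-- `Ẑ` (the tree's `Literature.IUT.HodgeTheaters.ZHat`). [folklore] -/
abbrev Zh : Type := Literature.IUT.HodgeTheaters.ZHat

/-- `μ_3 = ℤ/3ℤ`, written multiplicatively. [folklore] -/
abbrev Mu : Type := Multiplicative (ZMod 3)

/-- `Ẑ × μ_3`, the underlying topological group of the toy mono-theta environment. [folklore] -/
abbrev P : Type := Zh × Mu

/-- The kernel of `Ẑ × μ_3 ↠ Ẑ` is `μ_3`. [folklore] -/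
def kerFstEquiv : (MonoidHom.fst Zh Mu).ker ≃* Mu where
  toFun x := (x : P).2
  invFun m := ⟨(1, m), by rw [MonoidHom.mem_ker]; rfl⟩
  left_inv x := Subtype.ext (Prod.ext ((MonoidHom.mem_ker).mp x.2).symm rfl)
  right_inv _ := rfl
  map_mul' _ _ := rfl

/-- **The toy `ThetaSetting`** (interface of [IUTchII] §1 p. 20): `N := 3`, `l := 3`, `p := 5`, `k := ℂ`,
`Π^tp := Ẑ =: G` with `aug := id` (so `Δ = 1`), model group `Ẑ × μ_3` with `D :=` the inner automorphisms and no
theta section. JUNK DATA — records only that the interface is inhabited by these values.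
[claim: Mochizuki2012, status: disputed] (IUTchII §1, kurims p.20) -/
@[reducible] def setting : ThetaSetting.{0} where
  N := 3
  l := 3
  l_prime := Nat.prime_three
  l_odd := by decide
  p := 5
  p_prime := Nat.prime_five
  p_odd := by decide
  p_ne_l := by decide
  k := ℂ
  hasPrimitiveRoot := ⟨Complex.exp (2 * Real.pi * Complex.I / (4 * 3 : ℕ)),
    Complex.isPrimitiveRoot_exp (4 * 3) (by decide)⟩
  PiX := TopGroup.of Zh
  Gk := TopGroup.of Zh
  aug := MonoidHom.id Zh
  aug_continuous := continuous_id
  aug_surjective := Function.surjective_id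
  modelPi := TopGroup.of P
  modelD := (MulAut.conj : P →* MulAut P).range
  modelD_inn := le_rfl
  modelD_continuous := fun φ hφ => continuous_of_mem_range_conj φ hφ
  modelTheta := ∅

/-! ## 3. The toy mono-theta environment and its Def. 1.1 output -/

/-- **The toy mono-theta environment** of `setting`: the model itself (`Π := Ẑ × μ_3`, `D := Inn`, `s^Θ := ∅`),
"isomorphic to the model" by the identity. [claim: Mochizuki2012, status: disputed] (IUTchII §1 Def 1.1, kurims p.20) -/
@[reducible] def mte : MonoThetaEnv setting where
  Pi := TopGroup.of P
  D := (MulAut.conj : P →* MulAut P).range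
  D_inn := le_rfl
  D_continuous := fun φ hφ => continuous_of_mem_range_conj φ hφ
  theta := ∅
  isModel := by
    refine ⟨ContinuousMulEquiv.refl P, ?_, ?_⟩
    · ext φ
      rw [Subgroup.mem_map]
      constructor
      · rintro ⟨ψ, hψ, rfl⟩
        have hid : (MulAut.congr (ContinuousMulEquiv.refl P).toMulEquiv).toMonoidHom ψ = ψ :=
          MulEquiv.ext fun _ => rfl
        exact hid ▸ hψ
      · intro hφ
        exact ⟨φ, hφ, MulEquiv.ext fun _ => rfl⟩
    · exact Set.image_empty _

/-- **The toy Def. 1.1 (i) output**: `Π_Y := Ẑ` (first projection), `Π_X := Ẑ ⊇ Π_Y` by the identity, `G := Ẑ` by the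
identity (so `Δ_X = 1 = Δ` of the setting), interior cyclotome `Ẑ/1 ≅ Ẑ`, exterior cyclotome
`Ker(Ẑ × μ_3 ↠ Ẑ) ≅ ℤ/3ℤ`, all actions trivial. [claim: Mochizuki2012, status: disputed] (IUTchII §1 Def 1.1 (i), kurims pp.20–21) -/
@[reducible] def recon : Reconstruction mte where
  PiY := TopGroup.of Zh
  projY := MonoidHom.fst Zh Mu
  projY_continuous := continuous_fst
  projY_surjective := Prod.fst_surjective
  projY_quotientMap := isOpenMap_fst.isQuotientMap continuous_fst Prod.fst_surjective
  isClosed_ker_projY := by rw [MonoidHom.coe_ker]; exact isClosed_singleton.preimage continuous_fst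
  PiX := TopGroup.of Zh
  inclY := MonoidHom.id Zh
  inclY_isOpenEmbedding := IsOpenEmbedding.id
  inclY_normal := ⟨fun n _ g => ⟨g * n * g⁻¹, rfl⟩⟩
  G := TopGroup.of Zh
  projG := MonoidHom.id Zh
  projG_continuous := continuous_id
  projG_surjective := Function.surjective_id
  projG_quotientMap := IsQuotientMap.id
  isClosed_ker_projG := by rw [MonoidHom.coe_ker]; exact isClosed_singleton.preimage continuous_id
  projG_corresponds := ⟨ContinuousMulEquiv.refl Zh, by
    rw [MonoidHom.ker_id, Subgroup.map_bot]
    exact (MonoidHom.ker_id (G := Zh)).symm⟩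
  intCyc := subSubquotient (⊤ : Subgroup Zh)
  intAct := 1
  int_iso_ZHat := ⟨wholeCarrierEquiv Zh⟩
  extAct := 1
  ext_iso_ZMod := ⟨kerFstEquiv⟩
  projG_inclY_surjective := Function.surjective_id
  outer_action_lifts := fun x => ⟨1, fun δ => by
    have h : ((δ : P)).1 = 1 := (MonoidHom.mem_ker).mp δ.2
    show ((δ : P)).1 = x * ((δ : P)).1 * x⁻¹
    rw [h, mul_one, mul_inv_cancel]⟩

/-- `(l·Δ_Θ)(M) ⊗ ℤ/3 ≅ ℤ/3` for the toy: `Ẑ/1 ≅ Ẑ`, then `Ẑ ⊗ ℤ/3 ≅ ℤ/3`.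
[claim: Mochizuki2012, status: disputed] (IUTchII §1 Def 1.1 (ii), kurims p.21) -/
def intModEquiv : ModPow recon.intCyc.carrier 3 ≃* Mu :=
  (ModelCyclotomes.modPowCongr (wholeCarrierEquiv Zh) 3).trans (zhatModPowEquiv 3)

/-- **The toy Def. 1.1 (ii) datum**: `(l·Δ_Θ)(M) ⊗ ℤ/3 ≅ ℤ/3 ≅ Π_μ(M)`; equivariance is trivial (all actions are `1`).
[claim: Mochizuki2012, status: disputed] (IUTchII §1 Def 1.1 (ii), kurims p.21) -/
@[reducible] def rigidity : CyclotomicRigidity recon where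
  iso := intModEquiv.trans kerFstEquiv.symm
  equivariant := fun x c => by simp only [MonoidHom.one_apply, MulAut.one_apply]

/-! ## 4. The toy Prop. 1.2 (ii) data and the Prop. 1.3 (i)(ii) data -/

/-- **The toy Prop. 1.2 (ii) INPUT**: `𝒞 := 𝒟 := Type`, base functor the identity, `B^temp(Π)⁰ := Type` for every
`Π`. JUNK DATA. [claim: Mochizuki2012, status: disputed] (IUTchII §1 Prop 1.2 (ii), kurims p.25) -/
@[reducible] def frd : TemperedFrobenioidData setting where
  C := Type
  D := Type
  base := 𝟭 Type
  Btemp0 := fun _ => Type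
  Btemp0_map := fun _ => CategoryTheory.Equivalence.refl
  baseEquiv := CategoryTheory.Equivalence.refl

/-- **The toy Prop. 1.2 (ii) OUTPUT** `M^Θ(𝒞)`: the toy environment with its Def. 1.1 (i) output.
[claim: Mochizuki2012, status: disputed] (IUTchII §1 Prop 1.2 (ii), kurims pp.25–26) -/
@[reducible] def envOfFrd : EnvOfFrobenioid frd where
  env := mte
  recon := recon
  baseEquiv := CategoryTheory.Equivalence.refl

/-- **The toy Prop. 1.3 (i) data**: `S := μ_3` (a type, object of `𝒞 = Type`), `μ_N(S) := O^×(S) :=` the Cayley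
image of `μ_3` in `Aut(S)`, `(l·Δ_Θ)_S ⊗ ℤ/3 :=` the same image read as a subquotient of `Aut(S^bs) = Aut(S)`.
[claim: Mochizuki2012, status: disputed] (IUTchII §1 Prop 1.3 (i), kurims p.26) -/
@[reducible] def cyc : FrobenioidCyclotomes envOfFrd where
  obj := Mu
  intS := subSubquotient (cayley Mu).range
  muN := (cayley Mu).range
  unitsS := (cayley Mu).range
  muN_le := le_rfl
  corrInt := intModEquiv.trans
    ((MonoidHom.ofInjective (cayley_injective Mu)).trans (subCarrierEquiv (cayley Mu).range).symm)
  corrExt := kerFstEquiv.trans (MonoidHom.ofInjective (cayley_injective Mu))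

/-- `μ_N(S) ≅ μ_3` for the toy. [claim: Mochizuki2012, status: disputed] (IUTchII §1 Prop 1.3 (i), kurims p.26) -/
def muNEquiv : cyc.muN ≃* Mu := (MonoidHom.ofInjective (cayley_injective Mu)).symm

/-- `(l·Δ_Θ)_S ⊗ ℤ/3 ≅ μ_3` for the toy. [claim: Mochizuki2012, status: disputed] (IUTchII §1 Prop 1.3 (i), kurims p.26) -/
def intSEquiv : cyc.intS.carrier ≃* Mu := (subCarrierEquiv (cayley Mu).range).trans muNEquiv

/-- **The toy Prop. 1.3 (ii) data**: all three [AbsTopIII] cyclotomes `:= μ_3`, both "natural isomorphisms" `:= id`,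
both correspondences `:=` the toy identifications. [claim: Mochizuki2012, status: disputed] (IUTchII §1 Prop 1.3 (ii), kurims p.26) -/
@[reducible] def bsGalData : BsGalData cyc where
  muMTM := Mu
  muG := Mu
  muPiX := Mu
  corGk_PiX := MulEquiv.refl Mu
  corMTM_G := MulEquiv.refl Mu
  corr_muN := muNEquiv
  corr_intS := intSEquiv

/-! ## 5. What holds at the toy -/

/-- F-0420 at the toy: the Prop. 1.3 (i)(ii) existence predicate `Prop13_i_ii` is INHABITED at a closed datum.
[claim: Mochizuki2012, status: disputed] (IUTchII §1 Prop 1.3 (i)(ii), kurims p.26) -/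
theorem prop13_i_ii_envOfFrd : Literature.IUT.HodgeArakelov.Prop13_i_ii envOfFrd := ⟨cyc, ⟨bsGalData⟩⟩

/-- F-0664 at the toy: `(*mono-Θ) = (*bs-Gal)` HOLDS for the toy data (both are the identification
`(l·Δ_Θ)_S ⊗ ℤ/3 ⥲ μ_3 ⥲ μ_N(S)`). [claim: Mochizuki2012, status: disputed] (IUTchII §1 Prop 1.3 (iii), kurims pp.26–27) -/
theorem prop13_iii_toy : Literature.IUT.HodgeArakelov.Prop13_iii rigidity cyc bsGalData := by
  rw [prop13_iii_iff]
  intro x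
  -- both sides are `x` read in `μ_N(S)` through the Cayley image
  have h1 : cyc.monoTheta rigidity x = (MonoidHom.ofInjective (cayley_injective Mu))
      ((MonoidHom.ofInjective (cayley_injective Mu)).symm (subCarrierEquiv (cayley Mu).range x)) := by
    show (kerFstEquiv.trans (MonoidHom.ofInjective (cayley_injective Mu)))
      ((intModEquiv.trans kerFstEquiv.symm)
        ((intModEquiv.trans ((MonoidHom.ofInjective (cayley_injective Mu)).trans
          (subCarrierEquiv (cayley Mu).range).symm)).symm x)) = _
    simp only [MulEquiv.trans_apply, MulEquiv.symm_trans_apply, MulEquiv.symm_symm, MulEquiv.apply_symm_apply]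
  have h2 : bsGalData.bsGal x = (MonoidHom.ofInjective (cayley_injective Mu))
      ((MonoidHom.ofInjective (cayley_injective Mu)).symm (subCarrierEquiv (cayley Mu).range x)) := rfl
  rw [h1, h2]

/-- The inversion of `μ_N(S) ≅ μ_3`, a NON-identity automorphism of the reference cyclotome.
[claim: Mochizuki2012, status: disputed] (IUTchII §1 Prop 1.3 (iii), kurims p.27) -/
def muNFlip : cyc.muN ≃* cyc.muN := muNEquiv.trans ((MulEquiv.inv Mu).trans muNEquiv.symm)

/-- `muNFlip ≠ id` (`ζ ≠ ζ⁻¹` for a primitive cube root of unity).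
[claim: Mochizuki2012, status: disputed] (IUTchII §1 Prop 1.3 (iii), kurims p.27) -/
theorem muNFlip_ne_refl : muNFlip ≠ MulEquiv.refl _ := by
  intro h
  have h1 := MulEquiv.congr_fun h (muNEquiv.symm (Multiplicative.ofAdd 1))
  rw [MulEquiv.refl_apply, muNFlip, MulEquiv.trans_apply, MulEquiv.trans_apply, MulEquiv.apply_symm_apply,
    MulEquiv.inv_apply] at h1
  have h2 := congrArg muNEquiv h1
  rw [MulEquiv.apply_symm_apply, MulEquiv.apply_symm_apply] at h2
  exact absurd h2 (by decide)

/-- The toy Prop. 1.3 (ii) data with the correspondence «`μ_N(S)` corresponds to `μ_Ẑ(M_TM) ⊗ ℤ/3`» RE-GAUGED by the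
inversion `muNFlip` — equally well-typed Prop. 1.3 (ii) data over the same `Z`.
[claim: Mochizuki2012, status: disputed] (IUTchII §1 Prop 1.3 (ii), kurims p.26) -/
@[reducible] def bsGalDataFlip : BsGalData cyc :=
  { bsGalData with corr_muN := muNFlip.trans muNEquiv }

/-- F-0664 at the re-gauged toy: `(*mono-Θ) = (*bs-Gal)` FAILS (the two typed isomorphisms differ by `muNFlip ≠ id`).
[claim: Mochizuki2012, status: disputed] (IUTchII §1 Prop 1.3 (iii), kurims pp.26–27) -/
theorem not_prop13_iii_flip : ¬ Literature.IUT.HodgeArakelov.Prop13_iii rigidity cyc bsGalDataFlip := by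
  intro h
  have h0 : cyc.monoTheta rigidity = bsGalData.bsGal := prop13_iii_toy
  have h' : cyc.monoTheta rigidity = bsGalDataFlip.bsGal := h
  have e1 : bsGalData.bsGal = bsGalDataFlip.bsGal := h0.symm.trans h'
  have key : ∀ y : cyc.muN, muNFlip.symm y = y := fun y => by
    have e2 := MulEquiv.congr_fun e1 (intSEquiv.symm (muNEquiv y))
    have e3 : bsGalData.bsGal (intSEquiv.symm (muNEquiv y)) = y := by
      show muNEquiv.symm (intSEquiv (intSEquiv.symm (muNEquiv y))) = y
      rw [MulEquiv.apply_symm_apply, MulEquiv.symm_apply_apply]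
    have e4 : bsGalDataFlip.bsGal (intSEquiv.symm (muNEquiv y)) = muNFlip.symm y := by
      show muNFlip.symm (muNEquiv.symm (intSEquiv (intSEquiv.symm (muNEquiv y)))) = muNFlip.symm y
      rw [MulEquiv.apply_symm_apply, MulEquiv.symm_apply_apply]
    rw [e3, e4] at e2
    exact e2.symm
  apply muNFlip_ne_refl
  refine MulEquiv.ext fun y => ?_
  have e5 := congrArg muNFlip (key y)
  rw [MulEquiv.apply_symm_apply] at e5
  rw [MulEquiv.refl_apply]
  exact e5.symm

/-! ## 6. A second junk Frobenioid datum: one object with no non-identity automorphism -/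

/-- JUNK Prop. 1.2 (ii) INPUT no. 2: `𝒞 :=` one object whose only endomorphism is the identity (the full subcategory
of `Type` induced by `pt ↦ ∅`), `𝒟 := Type`. [claim: Mochizuki2012, status: disputed] (IUTchII §1 Prop 1.2 (ii), kurims p.25) -/
@[reducible] def frdPoint : TemperedFrobenioidData setting where
  C := InducedCategory Type (fun _ : PUnit.{2} => PEmpty.{1})
  D := Type
  base := inducedFunctor _
  Btemp0 := fun _ => Type
  Btemp0_map := fun _ => CategoryTheory.Equivalence.refl
  baseEquiv := CategoryTheory.Equivalence.refl

/-- The toy environment as the Prop. 1.2 (ii) OUTPUT over the junk input no. 2.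
[claim: Mochizuki2012, status: disputed] (IUTchII §1 Prop 1.2 (ii), kurims pp.25–26) -/
@[reducible] def envOfFrdPoint : EnvOfFrobenioid frdPoint where
  env := mte
  recon := recon
  baseEquiv := CategoryTheory.Equivalence.refl

/-- F-0420 at junk input no. 2: `Prop13_i_ii` FAILS — `μ_N(S) ⊆ Aut(S)` would have to receive `Π_μ ≅ μ_3`, but
`Aut(S)` is trivial. [claim: Mochizuki2012, status: disputed] (IUTchII §1 Prop 1.3 (i), kurims p.26) -/
theorem not_prop13_i_ii_envOfFrdPoint : ¬ Literature.IUT.HodgeArakelov.Prop13_i_ii envOfFrdPoint := by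
  rintro ⟨Z, -⟩
  have hsub : ∀ a b : Aut Z.obj, a = b := fun a b =>
    CategoryTheory.Iso.ext (InducedCategory.hom_ext (ConcreteCategory.hom_ext _ _ fun x => (x : PEmpty).elim))
  have h1 : Z.corrExt (kerFstEquiv.symm (Multiplicative.ofAdd 1)) = Z.corrExt 1 :=
    Subtype.ext (hsub _ _)
  have h2 := congrArg kerFstEquiv (Z.corrExt.injective h1)
  rw [MulEquiv.apply_symm_apply] at h2
  exact absurd (h2.trans (map_one kerFstEquiv)) (by decide)

end Prop13Toy

end Literature.IUT.HodgeArakelov
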